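import Summits.BirchSwinnertonDyer.BirchSwinnertonDyer.Theorems.ThetaPartnerAtTwoSignedControlAtTwoH1SigmaNotTorsionOfRelaxed
import Summits.BirchSwinnertonDyer.BirchSwinnertonDyer.Theorems.ThetaPartnerAtTwoSignedControlAtTwoH1SigmaDualDefs
import Literature.NumberTheory.EllipticCurves.IwasawaTwistedInvariantsFiniteProofs
import HarnessLib

/-!
# The predicate `H1SigmaDualNotTorsion` («dual of `H¹(K_Σ/K_∞, E[p^∞])` not `Λ`-torsion») — adapters from its four printed sources and the
# consequence `rank_Λ Y = 1` over `ℚ`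

Crux K4 `SignedControlAtTwo` (stmt-BirchSwinnertonDyer-20309; routes `ThetaPartnerAtTwo` / `ResidualThetaTransportAtTwo`), line `eulerchar` v9
(lead `prover-bsd-wall-tp2-p3` g3). The K4 chain (`…OfPubTwoNotTorsionH1Sigma`) consumes the predicate `SignedEC.H1SigmaDualNotTorsion W p κ γ Σ₀`
(sibling Defs file). THIS FILE proves the adapters into it and the rank consequence:

* `h1SigmaDualNotTorsion_of_relaxedCount` — from the finite-level count (I1) `relaxedSelmer_torsion_card_growth` (any number field;
  `H1SigmaGrowth.not_isTorsion_dual_h1Sigma_of_relaxedCount`);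
* `h1SigmaDualNotTorsion_of_notTorsion_selmer` — from Greenberg's Thm. 1.7 form «`X(E/K_∞)` not torsion» (`Sel_∞ ⊆ H`, restriction of characters
  onto, `H1SigmaRank.not_isTorsion_of_not_isTorsion_selmerDualData`);
* `h1SigmaDualNotTorsion_of_infinite_twistedFixed` — from Greenberg's TWIST road (pp. 115–117, 124): infinitely many `u ≡ 1 (p)` with
  `{c ∈ H : conj_γ c = u·c}` infinite (contrapositive of the tree's generic `IwasawaDual.finite_setOf_int_infinite_fixedBy`);
* `h1SigmaDualNotTorsion_of_rank_eq_one` — from the weak-Leopoldt form «`rank_Λ Y = 1` for every datum» (Kato Thm. 12.4 via Prop. 4.12);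
* `rank_eq_one_of_h1SigmaDualNotTorsion` — over `ℚ` with `Sel_{p^∞}(E/ℚ)` finite: predicate ⇒ `rank_Λ Y = 1` (the PROVED corank count
  `H1SigmaCorank.h1Sigma_zpCorank_le_degree_holds_rat` bounds `rank_Λ Y ≤ rank_{ℤ_p} Y/TY ≤ 1`).

THEOREMS ONLY (no definition, no named fact, no `sorry`); nothing about any curve is asserted; BSD is not proved by any of this.

References: [GreenbergLNM1716] §1 Thm. 1.7, §3 Lemma 3.1, §4 pp. 113, 115–117, 119–120, 124, Prop. 4.12; [Washington1997] §13.2;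
[Kato2004Asterisque] Thm. 12.4.
-/

set_option autoImplicit false
-- the Theorems namespace of this sub repeats the summit name by design (D-0017 nested layout)
set_option linter.dupNamespace false

noncomputable section

open scoped Classical NumberField

universe u

open NumberField IsDedekindDomain

namespace Summit.BirchSwinnertonDyer.BirchSwinnertonDyer.Theorems.SignedEC

open Literature.NumberTheory.EllipticCurves Literature.NumberTheory.GaloisRepresentations
  WeierstrassCurve ZpExtension Literature.NumberTheory.EllipticCurves.Kobayashi2003
  Literature.NumberTheory.EllipticCurves.IwasawaDual Literature.NumberTheory.EllipticCurves.IwasawaAlgebra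
  Literature.NumberTheory.EllipticCurves.GreenbergVatsal2000 Literature.NumberTheory.EllipticCurves.Rank1Residual

section Adapters

variable {K : Type u} [Field K] [NumberField K] (W : WeierstrassCurve K) [W.IsElliptic] {p : ℕ} [Fact p.Prime]
  (κ : ZpExtension K p) {γ : Field.absoluteGaloisGroup K}

/-! ## §0 Adapters: the predicate from (I1), from Thm. 1.7, from the twist road, from weak Leopoldt; and `rank_Λ Y = 1` from it -/

/-- **(I1) ⇒ `H1SigmaDualNotTorsion`** (any number field, cyclotomic `κ`, `γ` a topological generator, good reduction off `Σ₀ ∪ {v ∣ p}`):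
`H1SigmaGrowth.not_isTorsion_dual_h1Sigma_of_relaxedCount` at the place `v ∣ p`. [cite: GreenbergLNM1716, §4 p. 113, §1 p. 62, §3 Lemma 3.1] -/
theorem h1SigmaDualNotTorsion_of_relaxedCount (hκ : κ.IsCyclotomic) (hγ : κ.IsTopGenerator γ)
    {S₀ : Set (HeightOneSpectrum (𝓞 K))}
    (hgood : ∀ u : HeightOneSpectrum (𝓞 K), u ∉ S₀ → ((p : ℕ) : 𝓞 K) ∉ u.asIdeal → W.HasGoodReductionAt u)
    {v : HeightOneSpectrum (𝓞 K)} (hpv : (p : 𝓞 K) ∈ v.asIdeal)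
    (hI1 : WeierstrassCurve.relaxedSelmer_torsion_card_growth.{u}) : H1SigmaDualNotTorsion W p κ γ S₀ :=
  fun _ _ _ _ dY hbij hT hC ↦ H1SigmaGrowth.not_isTorsion_dual_h1Sigma_of_relaxedCount W κ hκ hγ hgood hpv hI1 dY hbij hT hC

/-- **Thm. 1.7 form ⇒ `H1SigmaDualNotTorsion`**: if the canonical Iwasawa module `X(E/K_∞)` (`W.selmerDualData κ hγ`) is not `Λ`-torsion
then neither is any dual datum of `H¹(K_Σ/K_∞, E[p^∞]) ⊇ Sel_∞` (`H1SigmaRank.not_isTorsion_of_not_isTorsion_selmerDualData`).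
[cite: GreenbergLNM1716, §1 Thm. 1.7] -/
theorem h1SigmaDualNotTorsion_of_notTorsion_selmer (hγ : κ.IsTopGenerator γ) {S₀ : Set (HeightOneSpectrum (𝓞 K))}
    (hgood : ∀ u : HeightOneSpectrum (𝓞 K), u ∉ S₀ → ((p : ℕ) : 𝓞 K) ∉ u.asIdeal → W.HasGoodReductionAt u)
    (hNT : ¬ (W.selmerDualData κ hγ).IsTorsion) : H1SigmaDualNotTorsion W p κ γ S₀ :=
  fun _ _ _ _ dY hbij hT hC ↦ H1SigmaRank.not_isTorsion_of_not_isTorsion_selmerDualData W κ hγ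
    (H1SigmaRank.selmerInfty_le_unramifiedOutside W κ S₀ hgood)
    (fun _ hc ↦ conjH1_mem_unramifiedOutside κ.kerSubgroup (W.geomPrimaryTorsion p) p _ γ hc) dY hbij hT hC hNT

omit [W.IsElliptic] in
/-- **The twist road ⇒ `H1SigmaDualNotTorsion`** (Greenberg LNM 1716 pp. 115–117 / p. 124: `𝒜[θ_s] = A_{−s}`): if for infinitely many integers
`u ≡ 1 (mod p)` the set `{c ∈ H¹(K_Σ/K_∞, E[p^∞]) : conj_γ c = u · c}` is infinite, then no finitely generated dual datum of `H¹(K_Σ/K_∞, E[p^∞])` is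
`Λ`-torsion — contrapositive of the tree's generic `IwasawaDual.finite_setOf_int_infinite_fixedBy` («for a f.g. TORSION dual, all but finitely
many twists have finite twisted invariants»). The expected source of the hypothesis is the LEVEL-`K` Poitou–Tate count for the finite twisted
modules `E[p^k] ⊗ χ_u`. [cite: GreenbergLNM1716, §4 pp. 115–117, 124] [cite: Washington1997, §13.2] -/
theorem h1SigmaDualNotTorsion_of_infinite_twistedFixed {S₀ : Set (HeightOneSpectrum (𝓞 K))}
    (htw : {u : ℤ | (p : ℤ) ∣ u - 1 ∧
      {c : unramifiedOutside κ.kerSubgroup (W.geomPrimaryTorsion p) p S₀ |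
        W.conjH1 p κ.kerSubgroup γ (c : W.subgroupH1 p κ.kerSubgroup) = u • (c : W.subgroupH1 p κ.kerSubgroup)}.Infinite}.Infinite) :
    H1SigmaDualNotTorsion W p κ γ S₀ := by
  intro Y _ _ _ dY hbij hT hC hY
  -- the restricted conjugation `φ = conj_γ|` on `H`
  let φ : AddMonoid.End (unramifiedOutside κ.kerSubgroup (W.geomPrimaryTorsion p) p S₀) :=
    AddMonoidHom.mk' (fun c ↦ ⟨W.conjH1 p κ.kerSubgroup γ c,
        conjH1_mem_unramifiedOutside κ.kerSubgroup (W.geomPrimaryTorsion p) p _ γ c.2⟩)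
      (fun a b ↦ Subtype.ext (by
        change W.conjH1 p κ.kerSubgroup γ ((a : W.subgroupH1 p κ.kerSubgroup) + b) =
          W.conjH1 p κ.kerSubgroup γ a + W.conjH1 p κ.kerSubgroup γ b
        exact map_add _ _ _))
  have hT' : ∀ (y : Y) (s : unramifiedOutside κ.kerSubgroup (W.geomPrimaryTorsion p) p S₀),
      dY ((PowerSeries.X : IwasawaAlgebra p) • y) s = dY y (φ s) - dY y s := fun y s ↦ hT y s
  have htor : ∀ s : unramifiedOutside κ.kerSubgroup (W.geomPrimaryTorsion p) p S₀, ∃ k : ℕ, p ^ k • s = 0 := fun s ↦ by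
    obtain ⟨k, hk⟩ := W.exists_pow_smul_subgroupH1_ker_eq_zero κ (s : W.subgroupH1 p κ.kerSubgroup)
    exact ⟨k, Subtype.ext (by rw [AddSubgroupClass.coe_nsmul]; exact hk)⟩
  have hfin := Literature.NumberTheory.EllipticCurves.IwasawaDual.finite_setOf_int_infinite_fixedBy φ dY hY htor hT' hC hbij
  refine htw (hfin.subset fun u hu ↦ ⟨hu.1, fun hfinu ↦ hu.2 ?_⟩)
  -- the two descriptions of the twisted-fixed set agree
  refine (hfinu.subset fun c hc ↦ ?_)
  have hc' : W.conjH1 p κ.kerSubgroup γ (c : W.subgroupH1 p κ.kerSubgroup) = u • (c : W.subgroupH1 p κ.kerSubgroup) := hc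
  show φ c = u • c
  exact Subtype.ext (by rw [AddSubgroupClass.coe_zsmul]; exact hc')

omit [W.IsElliptic] in
/-- **Weak-Leopoldt form ⇒ `H1SigmaDualNotTorsion`**: a datum of `Λ`-rank `1` is not torsion. [cite: GreenbergLNM1716, Prop. 4.12] -/
theorem h1SigmaDualNotTorsion_of_rank_eq_one {S₀ : Set (HeightOneSpectrum (𝓞 K))}
    (hWL : ∀ (Y : Type u) [AddCommGroup Y] [Module (IwasawaAlgebra p) Y] [Module.Finite (IwasawaAlgebra p) Y]
      (dY : Y →+ (unramifiedOutside κ.kerSubgroup (W.geomPrimaryTorsion p) p S₀ →+ AddCircle (1 : ℚ))),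
      Function.Bijective dY →
      (∀ (y : Y) (c : unramifiedOutside κ.kerSubgroup (W.geomPrimaryTorsion p) p S₀),
        dY ((PowerSeries.X : IwasawaAlgebra p) • y) c =
          dY y ⟨W.conjH1 p κ.kerSubgroup γ c,
            conjH1_mem_unramifiedOutside κ.kerSubgroup (W.geomPrimaryTorsion p) p _ γ c.2⟩ - dY y c) →
      (∀ (a : ℤ_[p]) (y : Y) (c : unramifiedOutside κ.kerSubgroup (W.geomPrimaryTorsion p) p S₀) (k : ℕ),
        (p ^ k) • c = 0 → dY (PowerSeries.C a • y) c = (PadicInt.toZModPow k a).val • dY y c) →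
      Module.rank (IwasawaAlgebra p) Y = 1) :
    H1SigmaDualNotTorsion W p κ γ S₀ := by
  intro Y _ _ _ dY hbij hT hC hY
  have h0 : Module.finrank (IwasawaAlgebra p) Y = 0 := Module.finrank_eq_zero_iff_isTorsion.mpr hY
  have h1 := hWL Y dY hbij hT hC
  rw [Module.finrank, h1, map_one] at h0
  exact one_ne_zero h0

end Adapters

/-- **`rank_Λ Y = 1` over `ℚ` from the predicate and the PROVED corank count** (`Sel_{p^∞}(E/ℚ)` finite; `γ` a topological generator):
`rank_Λ Y ≥ 1` by `H1SigmaDualNotTorsion`, `rank_Λ Y ≤ rank_{ℤ_p} Y/TY = corank_{ℤ_p} H¹(ℚ_Σ/ℚ, E[p^∞]) ≤ 1`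
(`H1SigmaRank.rank_eq_one_of_not_isTorsion_of_coinvariantsRank_le_one`, `SSFlatEC.coinvariantsRank_eq_zpCorank_unramifiedOutside_top`,
`H1SigmaCorank.h1Sigma_zpCorank_le_degree_holds_rat`). [cite: GreenbergLNM1716, §4 pp. 113, 119–120] -/
theorem rank_eq_one_of_h1SigmaDualNotTorsion (W : WeierstrassCurve ℚ) [W.IsElliptic] (p : ℕ) [Fact p.Prime]
    (κ : ZpExtension ℚ p) (γ : Field.absoluteGaloisGroup ℚ) (hγ : κ.IsTopGenerator γ) (S₀ : Finset (HeightOneSpectrum (𝓞 ℚ)))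
    (hgood : ∀ v : HeightOneSpectrum (𝓞 ℚ), v ∉ S₀ → ((p : ℕ) : 𝓞 ℚ) ∉ v.asIdeal → W.HasGoodReductionAt v)
    (hNT : H1SigmaDualNotTorsion W p κ γ (↑S₀ : Set (HeightOneSpectrum (𝓞 ℚ)))) (hSel : Finite (W.selmerGroupPInfty p))
    (Y : Type) [AddCommGroup Y] [Module (IwasawaAlgebra p) Y] [Module.Finite (IwasawaAlgebra p) Y]
    (dY : Y →+ (unramifiedOutside κ.kerSubgroup (W.geomPrimaryTorsion p) p
      (↑S₀ : Set (HeightOneSpectrum (𝓞 ℚ))) →+ AddCircle (1 : ℚ)))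
    (hbij : Function.Bijective dY)
    (hT : ∀ (y : Y) (c : unramifiedOutside κ.kerSubgroup (W.geomPrimaryTorsion p) p
        (↑S₀ : Set (HeightOneSpectrum (𝓞 ℚ)))),
      dY ((PowerSeries.X : IwasawaAlgebra p) • y) c =
        dY y ⟨W.conjH1 p κ.kerSubgroup γ c,
          conjH1_mem_unramifiedOutside κ.kerSubgroup (W.geomPrimaryTorsion p) p _ γ c.2⟩ - dY y c)
    (hC : ∀ (a : ℤ_[p]) (y : Y) (c : unramifiedOutside κ.kerSubgroup (W.geomPrimaryTorsion p) p
        (↑S₀ : Set (HeightOneSpectrum (𝓞 ℚ)))) (k : ℕ), (p ^ k) • c = 0 →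
      dY (PowerSeries.C a • y) c = (PadicInt.toZModPow k a).val • dY y c) :
    Module.rank (IwasawaAlgebra p) Y = 1 := by
  have hgood' : ∀ w : HeightOneSpectrum (𝓞 ℚ), w ∉ (↑S₀ : Set (HeightOneSpectrum (𝓞 ℚ))) →
      ((p : ℕ) : 𝓞 ℚ) ∉ w.asIdeal → W.HasGoodReductionAt w :=
    fun w hw hpw ↦ hgood w (fun h ↦ hw (Finset.mem_coe.mpr h)) hpw
  refine H1SigmaRank.rank_eq_one_of_not_isTorsion_of_coinvariantsRank_le_one p (hNT Y dY hbij hT hC) ?_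
  rw [SSFlatEC.coinvariantsRank_eq_zpCorank_unramifiedOutside_top W κ hγ S₀.finite_toSet dY hbij hT hC]
  have h := H1SigmaCorank.h1Sigma_zpCorank_le_degree_holds_rat W p hSel (↑S₀ : Set (HeightOneSpectrum (𝓞 ℚ))) S₀.finite_toSet hgood'
  rwa [Module.finrank_self] at h


end Summit.BirchSwinnertonDyer.BirchSwinnertonDyer.Theorems.SignedEC

end
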